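import Mathlib

/-!
# `DigitRung` (stmt-QuantumAdvantage-2423) — no 2-adic main-term bias at any digit depth (negative-side support)

Why the cheapest conceivable counterexample to the crux — a 2-adic density bias of `#Cl₃(−d)` at a
FIXED binary digit — does not exist: discriminant counts of binary cubic forms over `ℤ/2ᵏ` are
invariant under multiplication by sixth powers of units (`(x, y) ↦ (s x, y)`), and those are exactly
the units `≡ 1 (mod 8)`; so the distribution of `Disc mod 2ᵏ` (also restricted to maximal /
nowhere-totally-ramified forms, the substitution being a `GL₂` change of variables) carries no
information at digits `≥ 3` beyond the 2-adic square class, and the main term of `#Cl₃` has mean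
exactly `2` in every class mod `2^{j+1}`. Landed from `Cruxes/DigitRung/Disproof.lean` §4.

* `card_cubicDisc_eq_mul_unit_pow_six`, `pow_six_odd_mod_64`.
-/

namespace Summit.QuantumAdvantage.DigitRung.Negative

open Finset

/-! ## No 2-adic main-term bias at any digit depth (finite shadow) -/

/-- The discriminant of the binary cubic form `a x³ + b x² y + c x y² + d y³`. -/
def cubicDisc {R : Type*} [CommRing R] (a b c d : R) : R :=
  b ^ 2 * c ^ 2 - 4 * a * c ^ 3 - 4 * b ^ 3 * d - 27 * a ^ 2 * d ^ 2 + 18 * a * b * c * d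

/-- `Disc(f(s x, y)) = s⁶ · Disc(f(x, y))`. [folklore] -/
theorem cubicDisc_scale {R : Type*} [CommRing R] (s a b c d : R) :
    cubicDisc (s ^ 3 * a) (s ^ 2 * b) (s * c) d = s ^ 6 * cubicDisc a b c d := by
  unfold cubicDisc; ring

/-- The substitution `(x, y) ↦ (s x, y)` on coefficient quadruples. -/
def scale {R : Type*} [CommRing R] (s : R) (f : R × R × R × R) : R × R × R × R :=
  (s ^ 3 * f.1, s ^ 2 * f.2.1, s * f.2.2.1, f.2.2.2)

/-- `scale s⁻¹ ∘ scale s = id`. [folklore] -/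
theorem scale_scale_inv {R : Type*} [CommRing R] (s : Rˣ) (f : R × R × R × R) :
    scale (↑s⁻¹ : R) (scale (↑s : R) f) = f := by
  obtain ⟨a, b, c, d⟩ := f
  simp only [scale, Prod.mk.injEq]
  refine ⟨?_, ?_, ?_, trivial⟩
  · rw [← mul_assoc, ← mul_pow, Units.inv_mul, one_pow, one_mul]
  · rw [← mul_assoc, ← mul_pow, Units.inv_mul, one_pow, one_mul]
  · rw [← mul_assoc, Units.inv_mul, one_mul]

/-- `scale s ∘ scale s⁻¹ = id`. [folklore] -/
theorem scale_inv_scale {R : Type*} [CommRing R] (s : Rˣ) (f : R × R × R × R) :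
    scale (↑s : R) (scale (↑s⁻¹ : R) f) = f := by
  simpa using scale_scale_inv s⁻¹ f

/-- **Discriminant counts are invariant under unit sixth powers.** For every unit `s` of a finite
commutative ring `R` (e.g. `ZMod (2^k)`) and every `r`, the binary cubic forms over `R` with
discriminant `r` are in bijection with those of discriminant `s⁶ r`, by `(x, y) ↦ (s x, y)`.
Over `ℤ/2ᵏ` (`k ≥ 3`) the sixth powers of units are exactly the units `≡ 1 (mod 8)`, so the count
depends on a unit `r` only through `r mod 8`: the distribution of `Disc mod 2ᵏ` carries no
information at binary digits `≥ 3` beyond the 2-adic square class. Since `(x, y) ↦ (s x, y)` is a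
`GL₂`-change of variables, the same holds for the sub-counts of forms whose cubic ring is maximal /
not totally ramified at `2` — the local content of the planner's "mean 2 in every class mod 2^{j+1}".
[folklore] -/
theorem card_cubicDisc_eq_mul_unit_pow_six {R : Type*} [CommRing R] [Fintype R] [DecidableEq R]
    (s : Rˣ) (r : R) :
    (Finset.univ.filter fun f : R × R × R × R => cubicDisc f.1 f.2.1 f.2.2.1 f.2.2.2 = r).card =
      (Finset.univ.filter fun f : R × R × R × R =>
        cubicDisc f.1 f.2.1 f.2.2.1 f.2.2.2 = (s : R) ^ 6 * r).card := by
  refine Finset.card_nbij' (scale (↑s : R)) (scale (↑s⁻¹ : R)) (fun f hf => ?_) (fun f hf => ?_)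
    (fun f _ => scale_scale_inv s f) (fun f _ => scale_inv_scale s f)
  · simp only [Finset.mem_coe, Finset.mem_filter, Finset.mem_univ, true_and] at hf ⊢
    rw [scale, cubicDisc_scale, hf]
  · simp only [Finset.mem_coe, Finset.mem_filter, Finset.mem_univ, true_and] at hf ⊢
    rw [scale, cubicDisc_scale, hf, ← mul_assoc, ← mul_pow, Units.inv_mul, one_pow, one_mul]

/-- The sixth powers of the odd residues mod `64` are exactly the residues `≡ 1 (mod 8)` (checked
by `decide`; the same holds mod every `2ᵏ`, `k ≥ 3`, since `(ℤ/2ᵏ)ˣ ≅ C₂ × C_{2^{k-2}}` and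
`x ↦ x³` is bijective on a 2-group). With `card_cubicDisc_eq_mul_unit_pow_six`: the number of
binary cubic forms mod `64` of discriminant `a` is the same for all odd `a` in a class mod `8`.
[folklore] -/
theorem pow_six_odd_mod_64 :
    (∀ s : Fin 64, s.val % 2 = 1 → s.val ^ 6 % 64 % 8 = 1) ∧
      (∀ u : Fin 64, u.val % 8 = 1 → ∃ s : Fin 64, s.val % 2 = 1 ∧ s.val ^ 6 % 64 = u.val) := by
  refine ⟨by decide +kernel, by decide +kernel⟩

end Summit.QuantumAdvantage.DigitRung.Negative
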